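import Summits.CriticalPhenomena.PercolationContinuityZ3.Theorems.PercNearOneGluingNoHeavyLowerTailSunflowerMultiPetalKempeMarkedUnpairedTI
import HarnessLib
import HarnessLib.Audit

/-!
# `NoHeavyLowerTail` (crux stmt-CriticalPhenomena-4575), marked-multigraph layer: the UNPAIRED step law at outer degree ONE (`y ≁ v`)

Support file (seat `prim-l12-p2` gen 54; `--supports stmt-CriticalPhenomena-4575`; sequel of `…KempeMarkedUnpairedTI`, template `…KempeMarkedStepOne`).  No `sorry`;
nothing is asserted about the crux.  Memo: run/shared/lean/prim/prim-l12/prim-l12-p2/FINDING-g54-UNPAIRED-ALL-D-LAW.md §2; FINDING-g53-UNPAIRED-STEP-LAWS.md §3(a).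

THEOREM U needs `|S| ≥ 2`.  For `|S| = 1` (`S = {s}`, `y ∼ u` unmarked, `y ≁ v`) no cellwise law exists, but gen 53's LP law
`T(K) ≥ 4/3·T(K') + 2/3·T(K'/su) + T((K'/sv)⁺ᵘ) + 1/3·T(K'⁺ᵘ)` is positive ROW BY ROW (each row = the three recolourings of `s`), for both `mul y u ∈ {1, ≥2}`.
Here it is kernel-checked: `rowU1` (the row as a function of the base type, the profile of `s` and the flags), the finite check `rowU1_nonneg` (`3⁶·4` cases),
the row identity `sum_res1_update_eq`, `sum_res1_nonneg`, the identifications of the two marked minors, and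
**`TfunM_step_unpaired_one`**: `12·T(K.isolate y) + 2·T(K.peelContract y {s} u) + 3·T((K.peelContract y {s} v)⁺ᵘ) + 3·T((K.isolate y)⁺ᵘ) ≤ 27·T(K)`,
i.e. the law above after removing the free-vertex factors.  With `TfunM_step_unpaired` (|S| ≥ 2), `TfunM_step_unpaired_both` (y ∼ u, v) and the degree-0 identity this is an
unpaired law at EVERY outer degree for every unmarked `y ∼ u` (memo §2).
-/

namespace Summit.CriticalPhenomena.PercolationContinuityZ3.Theorems.SunflowerPartition.Kempe

open Finset

/-- The unpaired `|S| = 1` ROW (scaled by `3`): cells `s ↦ 0, 1, 2` at base type `t`, profile `φ` of `s`, flags `(A,B,C) = (mul y u, mul y v, mul y s) ∧ 2`: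
`Σ_c [3·kerTAbs t_c k_c − fC t_c − fC(t_c ⊕ e₀)] − 2·fC t₀ − 3·fC(t₁ ⊕ e₀)` with `t_c = t ⊕ φ_c e_c`. [this work] -/
def rowU1 (t φ : CType) (A B C : Fin 3) : ℤ :=
  3 * (kerTAbs (ctAdd t (xPart 0 φ)) (capAdd A C, B, 0) + kerTAbs (ctAdd t (xPart 1 φ)) (A, capAdd B C, 0) + kerTAbs (ctAdd t (xPart 2 φ)) (A, B, C))
    - (fC (ctAdd t (xPart 0 φ)) + fC (ctAdd t (xPart 1 φ)) + fC (ctAdd t (xPart 2 φ)))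
    - 2 * fC (ctAdd t (xPart 0 φ)) - 3 * fC (ctAdd (ctAdd t (xPart 1 φ)) (1, 0, 0))
    - (fC (ctAdd (ctAdd t (xPart 0 φ)) (1, 0, 0)) + fC (ctAdd (ctAdd t (xPart 1 φ)) (1, 0, 0)) + fC (ctAdd (ctAdd t (xPart 2 φ)) (1, 0, 0)))

/-- **The unpaired `|S| = 1` row is nonnegative** for `y ∼ u` (`A ≠ 0`), `y ∼ s` (`C ≠ 0`), `y ≁ v` (`B = 0`). (finite check, `3⁶·4` cases) [this work] -/
theorem rowU1_nonneg : ∀ (t φ : CType) (A C : Fin 3), A ≠ 0 → C ≠ 0 → 0 ≤ rowU1 t φ A 0 C := by decide +kernel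

namespace MGraph

variable {V : Type*} [Fintype V] [LinearOrder V] (K : MGraph V)

section UnpairedOne

variable (y s : V)

/-- The unpaired `|S| = 1` cell residual (scaled by `3`). [this work] -/
def res1 (ρ : V → Fin 3) : ℤ :=
  3 * kerTAbs ((K.isolate y).ctypeM ρ) (K.profM y ρ) - fC ((K.isolate y).ctypeM ρ)
    - 2 * (if ρ s = 0 then fC ((K.isolate y).ctypeM ρ) else 0) - 3 * (if ρ s = 1 then fC (ctAdd ((K.isolate y).ctypeM ρ) (1, 0, 0)) else 0)
    - fC (ctAdd ((K.isolate y).ctypeM ρ) (1, 0, 0))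

variable {K y s}
variable {u v : V}

/-- **Row identity**: the three cells `ρ[s ↦ c]` of `res1` sum to `rowU1` at the graph's parameters. [this work] -/
theorem sum_res1_update_eq (hS : ∀ w, w ∈ ({s} : Finset V) ↔ (w ≠ u ∧ w ≠ v ∧ w ≠ y ∧ K.mul y w ≠ 0)) (huv : u ≠ v) (hyu : y ≠ u) (hyv : y ≠ v)
    (hmy : K.mark y = 0) (ρ : V → Fin 3) (hu : ρ u = 0) (hv : ρ v = 1) :
    ∑ c : Fin 3, K.res1 y s (Function.update ρ s c)
      = rowU1 (((K.isolate y).isolate s).ctypeM ρ) ((K.isolate y).profM s ρ) (cap3 (K.mul y u)) (cap3 (K.mul y v)) (cap3 (K.mul y s)) := by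
  have ht : ∀ c, (K.isolate y).ctypeM (Function.update ρ s c) = ctAdd (((K.isolate y).isolate s).ctypeM ρ) (xPart c ((K.isolate y).profM s ρ)) := by
    intro c
    rw [(K.isolate y).ctypeM_eq_ctAdd_isolate s (Function.update ρ s c), Function.update_self, (K.isolate y).ctypeM_isolate_update s ρ c,
      (K.isolate y).profM_update_self s ρ c]
  have h10 : ¬((1 : Fin 3) = 0) := by decide
  have h20 : ¬((2 : Fin 3) = 0) := by decide
  have h01 : ¬((0 : Fin 3) = 1) := by decide
  have h02 : ¬((0 : Fin 3) = 2) := by decide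
  have h12 : ¬((1 : Fin 3) = 2) := by decide
  have h21 : ¬((2 : Fin 3) = 1) := by decide
  rw [Fin.sum_univ_three]
  unfold res1 rowU1
  rw [ht 0, ht 1, ht 2, profM_update_eq hS huv hyu hyv hmy ρ hu hv 0, profM_update_eq hS huv hyu hyv hmy ρ hu hv 1,
    profM_update_eq hS huv hyu hyv hmy ρ hu hv 2]
  simp only [Function.update_self, if_true, h10, h20, h01, h02, h12, h21, if_false, MGraph.capAdd_zero_right, sub_zero, mul_zero]
  ring

/-- **The unpaired `|S| = 1` residual sum is nonnegative** (rows of three cells, each row `≥ 0`; no pairing). [this work] -/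
theorem sum_res1_nonneg (hS : ∀ w, w ∈ ({s} : Finset V) ↔ (w ≠ u ∧ w ≠ v ∧ w ≠ y ∧ K.mul y w ≠ 0)) (huv : u ≠ v) (hyu : y ≠ u) (hyv : y ≠ v)
    (hmy : K.mark y = 0) (hyu' : K.mul y u ≠ 0) (hv0 : K.mul y v = 0) :
    0 ≤ ∑ ρ ∈ univ.filter (fun ρ : V → Fin 3 => ρ u = 0 ∧ ρ v = 1), K.res1 y s ρ := by
  have hsu : s ≠ u := ((hS s).1 (mem_singleton_self s)).1
  have hsv : s ≠ v := ((hS s).1 (mem_singleton_self s)).2.1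
  have hys : K.mul y s ≠ 0 := ((hS s).1 (mem_singleton_self s)).2.2.2
  have hA : cap3 (K.mul y u) ≠ 0 := fun h => hyu' ((eq_zero_iff_cap3 _).2 h)
  have hC : cap3 (K.mul y s) ≠ 0 := fun h => hys ((eq_zero_iff_cap3 _).2 h)
  set F := univ.filter (fun ρ : V → Fin 3 => ρ u = 0 ∧ ρ v = 1) with hF
  have memF : ∀ ρ, ρ ∈ F ↔ ρ u = 0 ∧ ρ v = 1 := fun ρ => by rw [hF, mem_filter]; simp
  have hrow : ∑ ρ ∈ F, ∑ c : Fin 3, K.res1 y s (Function.update ρ s c) = 3 * ∑ ρ ∈ F, K.res1 y s ρ := by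
    rw [sum_comm]
    have h3 : ∀ c : Fin 3, ∑ ρ ∈ F, K.res1 y s (Function.update ρ s c) = 3 * ∑ ρ ∈ F, (if ρ s = c then K.res1 y s ρ else 0) :=
      fun c => sum_update_eq_three_mul_col s u v hsu.symm hsv.symm c _
    simp only [h3]
    rw [← mul_sum, sum_comm]
    congr 1
    refine sum_congr rfl fun ρ _ => ?_
    rw [sum_ite_eq univ (ρ s), if_pos (mem_univ _)]
  have hrows : 0 ≤ ∑ ρ ∈ F, ∑ c : Fin 3, K.res1 y s (Function.update ρ s c) := by
    refine sum_nonneg fun ρ hρ => ?_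
    obtain ⟨hu, hv⟩ := (memF ρ).1 hρ
    rw [sum_res1_update_eq hS huv hyu hyv hmy ρ hu hv, hv0, cap3_zero]
    exact rowU1_nonneg _ _ _ _ hA hC
  rw [hrow] at hrows
  linarith

variable (K) (y u v s)

/-- `T((K.peelContract y {s} v)⁺ᵘ) = 3·Σ_{ρ u = 0, ρ v = 1} [ρ s = 1]·fC(type_{K−y} ρ ⊕ e₀)` (pin the free vertex `s` to the colour of `v`). [this work] -/
theorem TfunM_peel_single_right_addMark (hvy : v ≠ y) (hsu : s ≠ u) (hsv : s ≠ v) (hsy : s ≠ y) :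
    ((K.peelContract y {s} v).addMark u 1).TfunM u v
      = 3 * ∑ ρ ∈ univ.filter (fun ρ : V → Fin 3 => ρ u = 0 ∧ ρ v = 1), (if ρ s = 1 then fC (ctAdd ((K.isolate y).ctypeM ρ) (1, 0, 0)) else 0) := by
  set L := K.peelContract y {s} v with hL
  have hvS : v ∉ ({s} : Finset V) := fun h => hsv (mem_singleton.1 h).symm
  have hyS : y ∉ ({s} : Finset V) := fun h => hsy (mem_singleton.1 h).symm
  have hZ : ∀ z ∈ ({s} : Finset V), (L.addMark u 1).IsFree z := fun z hz => by
    rw [mem_singleton.1 hz]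
    exact L.isFree_addMark u 1 (K.isFree_peelContract_of_mem y v {s} (mem_singleton_self s)) hsu
  have h2 := (L.addMark u 1).sum_filter_eq_pow_mul fC {s} hZ (fun σ => σ u = 0 ∧ σ v = 1)
    (fun z hz σ c => by rw [mem_singleton.1 hz, Function.update_of_ne hsu.symm, Function.update_of_ne hsv.symm])
    (fun _ _ => 1) (fun _ _ _ _ _ _ => rfl)
  have h3 : ∑ σ ∈ univ.filter (fun σ : V → Fin 3 => (σ u = 0 ∧ σ v = 1) ∧ ∀ z ∈ ({s} : Finset V), σ z = (1 : Fin 3)), fC ((L.addMark u 1).ctypeM σ)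
      = ∑ σ ∈ univ.filter (fun σ : V → Fin 3 => (σ u = 0 ∧ σ v = 1) ∧ ∀ z ∈ ({s} : Finset V), σ z = (1 : Fin 3)), fC (ctAdd ((K.isolate y).ctypeM σ) (1, 0, 0)) := by
    refine sum_congr rfl fun σ hσ => ?_
    obtain ⟨⟨hu, hv⟩, hz⟩ := (mem_filter.1 hσ).2
    rw [L.ctypeM_addMark u 1 σ, hu, xPart_zero_mark, hL,
      K.ctypeM_peelContract_of_const y v {s} hvy hvS hyS σ (fun z hz' => by rw [hz z hz', hv])]
  have h4 : ∑ σ ∈ univ.filter (fun σ : V → Fin 3 => (σ u = 0 ∧ σ v = 1) ∧ ∀ z ∈ ({s} : Finset V), σ z = (1 : Fin 3)), fC (ctAdd ((K.isolate y).ctypeM σ) (1, 0, 0))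
      = ∑ ρ ∈ univ.filter (fun ρ : V → Fin 3 => ρ u = 0 ∧ ρ v = 1), (if ρ s = 1 then fC (ctAdd ((K.isolate y).ctypeM ρ) (1, 0, 0)) else 0) := by
    rw [sum_filter, sum_filter]
    refine sum_congr rfl fun σ _ => ?_
    by_cases hP : σ u = 0 ∧ σ v = 1
    · by_cases hQ : σ s = 1
      · rw [if_pos ⟨hP, fun z hz => by rw [mem_singleton.1 hz, hQ]⟩, if_pos hP, if_pos hQ]
      · rw [if_neg (fun h => hQ (h.2 s (mem_singleton_self s))), if_pos hP, if_neg hQ]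
    · rw [if_neg (fun h => hP h.1), if_neg hP]
  unfold TfunM
  rw [h2, h3, h4, card_singleton, pow_one]

/-- `T((K.isolate y)⁺ᵘ) = Σ_{ρ u = 0, ρ v = 1} fC(type_{K−y} ρ ⊕ e₀)`. [this work] -/
theorem TfunM_isolate_addMark (u v : V) :
    ((K.isolate y).addMark u 1).TfunM u v = ∑ ρ ∈ univ.filter (fun ρ : V → Fin 3 => ρ u = 0 ∧ ρ v = 1), fC (ctAdd ((K.isolate y).ctypeM ρ) (1, 0, 0)) := by
  unfold TfunM
  refine sum_congr rfl fun ρ hρ => ?_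
  rw [(K.isolate y).ctypeM_addMark u 1 ρ, ((mem_filter.1 hρ).2).1, xPart_zero_mark]

variable {K y u v s}

/-- **THE UNPAIRED STEP LAW AT OUTER DEGREE ONE — kernel-checked** (memo FINDING-g54 §2; gen 53's law, both `mul y u ∈ {1, ≥ 2}`): for terminals `u ≠ v`, an UNMARKED
non-terminal `y` with `mul y u ≠ 0`, `mul y v = 0` and exactly one outer neighbour `s`,
`12·T(K.isolate y) + 2·T(K.peelContract y {s} u) + 3·T((K.peelContract y {s} v)⁺ᵘ) + 3·T((K.isolate y)⁺ᵘ) ≤ 27·T(K)`,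
i.e. `T(K) ≥ 4/3·T(K') + 2/3·T(K'/su) + T((K'/sv)⁺ᵘ) + 1/3·T(K'⁺ᵘ)` after removing the free-vertex factors — every row nonnegative, no pairing. [this work] -/
theorem TfunM_step_unpaired_one (huv : u ≠ v) (hyu : y ≠ u) (hyv : y ≠ v) (hmark : K.mark y = 0) (hadj : K.mul y u ≠ 0) (hfar : K.mul y v = 0)
    (hS : ∀ w, w ∈ ({s} : Finset V) ↔ (w ≠ u ∧ w ≠ v ∧ w ≠ y ∧ K.mul y w ≠ 0)) :
    12 * (K.isolate y).TfunM u v + 2 * (K.peelContract y {s} u).TfunM u v + 3 * ((K.peelContract y {s} v).addMark u 1).TfunM u v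
      + 3 * ((K.isolate y).addMark u 1).TfunM u v ≤ 27 * K.TfunM u v := by
  have hsu : s ≠ u := ((hS s).1 (mem_singleton_self s)).1
  have hsv : s ≠ v := ((hS s).1 (mem_singleton_self s)).2.1
  have hsy : s ≠ y := ((hS s).1 (mem_singleton_self s)).2.2.1
  have huS : u ∉ ({s} : Finset V) := fun h => hsu (mem_singleton.1 h).symm
  have hvS : v ∉ ({s} : Finset V) := fun h => hsv (mem_singleton.1 h).symm
  have hyS : y ∉ ({s} : Finset V) := fun h => hsy (mem_singleton.1 h).symm
  set F := univ.filter (fun ρ : V → Fin 3 => ρ u = 0 ∧ ρ v = 1) with hF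
  -- the kernel sum (filtered machinery with the trivial filter)
  have hker : ∑ ρ ∈ F, kerTAbs ((K.isolate y).ctypeM ρ) (K.profM y ρ) = 3 * K.TfunM u v - (K.isolate y).TfunM u v := by
    have h := K.sum_kerTAbs_filter (fun _ => True) y u v hyu.symm hyv.symm (fun _ _ => Iff.rfl)
    have eF : univ.filter (fun ρ : V → Fin 3 => (ρ u = 0 ∧ ρ v = 1) ∧ True) = F := by
      rw [hF]; exact filter_congr fun ρ _ => iff_of_eq (and_true _)
    have eT : ∀ L : MGraph V, L.TfunF (fun _ => True) u v = L.TfunM u v := fun L => by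
      unfold TfunF TfunM; rw [eF]
    rw [eF, eT, eT] at h
    exact h
  have hiso : ∑ ρ ∈ F, fC ((K.isolate y).ctypeM ρ) = (K.isolate y).TfunM u v := rfl
  have hzero : ∑ ρ ∈ F, (if ρ s = 0 then fC ((K.isolate y).ctypeM ρ) else 0) = K.allZeroSum y {s} u v := by
    unfold allZeroSum
    refine sum_congr rfl fun ρ _ => if_congr ?_ rfl rfl
    simp only [mem_singleton, forall_eq]
  have hpeel := K.TfunM_peelContract y u v {s} hyu.symm huS hyS hvS
  have hone := K.TfunM_peel_single_right_addMark (y := y) (s := s) (u := u) (v := v) hyv.symm hsu hsv hsy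
  have hmarkU := K.TfunM_isolate_addMark y u v
  have hsum : ∑ ρ ∈ F, K.res1 y s ρ = 3 * (3 * K.TfunM u v - (K.isolate y).TfunM u v) - (K.isolate y).TfunM u v
      - 2 * K.allZeroSum y {s} u v - 3 * ∑ ρ ∈ F, (if ρ s = 1 then fC (ctAdd ((K.isolate y).ctypeM ρ) (1, 0, 0)) else 0)
      - ((K.isolate y).addMark u 1).TfunM u v := by
    unfold res1
    rw [sum_sub_distrib, sum_sub_distrib, sum_sub_distrib, sum_sub_distrib, ← mul_sum, ← mul_sum, ← mul_sum, hker, hiso, hzero, hmarkU]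
  have hnn := sum_res1_nonneg hS huv hyu hyv hmark hadj hfar (s := s)
  rw [← hF] at hnn
  rw [hsum] at hnn
  rw [hpeel, hone, card_singleton, pow_one]
  linarith

end UnpairedOne

end MGraph

end Summit.CriticalPhenomena.PercolationContinuityZ3.Theorems.SunflowerPartition.Kempe
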